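import Mathlib.Analysis.InnerProductSpace.PiL2
import Mathlib.Data.Set.Card
import Literature.Geometry.DiscreteGeometry.FejesTothKissingTwelve
import HarnessLib

/-!
# Kissing configurations are saturated spherical networks (Hales 2012, from Lemma 1 = `L12`)
# — proved

Topic `Literature/Geometry/DiscreteGeometry`; provefact item for `Hales2012_kissingTwelve`
(sibling of `FejesTothKissingTwelve.lean`, which it imports).  That file reduces Hales's
Theorem 1 to the computer-assisted named facts `flyspeck_L12` (Lemma 1) and
`Hales2012_contactGraphFccOrHcp` (Theorem 3 with Lemmas 8–9).  The proof of the main estimate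
(Theorem 2), on which Theorem 3 rests, uses Lemma 1 a second time, through the kissing number
problem: a twelve-point packing on `S²(2)` leaves no room for a thirteenth point.  We PROVE this
consequence of `flyspeck_L12` here, in the sharper form that the weights of `L12` actually give.

## Source

Hales, arXiv:1209.6043, proof of Theorem 2, p. 6: "By the kissing number problem, `V′`, which has
cardinality 12, is a saturated spherical network on `S²(2)`; that is, there is no room to add a
further point on `S²(2)` that has distance at least `2` from all points of `V′`. By this
saturation property, if `{u₁, u₂, u₃} ⊂ V′` is a Delaunay triangle, then the circumradius of the
simplex `{0, u₁, u₂, u₃}` is less than `2`."  The kissing number problem is the case of Lemma 1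
(`L12`: `∑_{v ∈ V} L(‖v‖/2) ≤ 12` for a packing `V` in the annulus `2 ≤ ‖v‖ ≤ 2h₀`,
`L(h) = (h₀ − h)/(h₀ − 1)`, `h₀ = 1.26`) in which all weights are `1`; the argument is the one
printed for Lemma 2 (p. 2): a thirteenth point `w` of the annulus at distance `≥ 2` from the
twelve points of norm `2` would give `12 + L(‖w‖/2) ≤ 12`, i.e. `‖w‖ ≥ 2h₀`.

## What is proved (namespace `Literature.DiscreteGeom`)

For `S ⊂ S²(2)` with twelve points at pairwise distance `≥ 2` (in particular for every
`S ∈ 𝒱`, `IsKissingConfig S`), assuming `flyspeck_L12`: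

* `exists_two_mul_h0_le_inner_of_L12`: for every `x ∈ S²(2)` there is `s ∈ S` with
  `⟪x, s⟫ ≥ 2h₀ = 2.52`, i.e. at angular distance `≤ arccos (h₀/2) = arccos 0.63 ≈ 50.95°` from
  `x` (the thirteenth point may be placed anywhere in the annulus, not only on `S²(2)`; letting
  its norm tend to `2h₀` gives this bound, and finiteness of `S` makes it attained);
* `exists_dist_le_of_L12`: hence some `s ∈ S` has `dist x s ≤ 2√(2 − h₀) ≈ 1.72`;
* `exists_dist_lt_two_of_L12`: in particular some `s ∈ S` has `dist x s < 2` — "`V′` is a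
  saturated spherical network on `S²(2)`" as printed;
* `not_packing_thirteen_of_L12`: equivalently, no `x ∈ S²(2)` is at distance `≥ 2` from all of
  `S` (no thirteenth kissing ball);
* the specialisations `IsKissingConfig.exists_two_mul_h0_le_inner`,
  `IsKissingConfig.exists_dist_lt_two` to Hales's class `𝒱`.

## References

* T. C. Hales, *A proof of Fejes Tóth's conjecture on sphere packings with kissing number twelve*,
  arXiv:1209.6043 (2012), Lemma 1 and proof of Lemma 2 (p. 2), proof of Theorem 2 (p. 6)
  (`Hales2012`).
* T. C. Hales, *Dense Sphere Packings. A Blueprint for Formal Proofs*, LMS Lecture Note Ser. 400,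
  CUP (2012), §6 (saturated packings) (`HalesDSP2012`).
-/

noncomputable section

namespace Literature.Geometry.DiscreteGeometry

open Finset RealInnerProductSpace

/-- `L(t) > 0` for `t < h₀` (the weight of a point of the open annulus is positive). [folklore] -/
theorem halesL_pos {t : ℝ} (h : t < hales_h0) : 0 < halesL t := by
  rw [halesL_apply]
  rw [hales_h0_eq] at h ⊢
  exact div_pos (by linarith) (by norm_num)

/-- On `S²(2)`: `dist x s ^ 2 = 8 − 2⟪x, s⟫`. [folklore] -/
theorem dist_sq_eq_of_norm_eq_two {x s : EuclideanSpace ℝ (Fin 3)} (hx : ‖x‖ = 2) (hs : ‖s‖ = 2) :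
    dist x s ^ 2 = 8 - 2 * ⟪x, s⟫ := by
  rw [dist_eq_norm, norm_sub_sq_real, hx, hs]
  ring

/-- **Twelve kissing points see every direction within `arccos (h₀/2)`** (from `L12`).  Let
`S ⊂ S²(2)` consist of twelve points at pairwise distance `≥ 2` and assume `flyspeck_L12`.  Then
for every `x` with `‖x‖ = 2` there is `s ∈ S` with `⟪x, s⟫ ≥ 2h₀` (`= 2.52`; as
`⟪x, s⟫ = 4 cos ∠(x, s)`, the angle is `≤ arccos 0.63`).  Proof: otherwise pick `ρ` with
`max (2, max_s ⟪x, s⟫) < ρ < 2h₀` and put `w = (ρ/2) x`; then `‖w‖ = ρ` lies in the annulus and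
`dist (w, s)² = ρ² + 4 − ρ⟪x, s⟫ > 4` for all `s ∈ S`, so `L12` applied to the thirteen points
`S ∪ {w}` gives `12 + L(ρ/2) ≤ 12`, contradicting `L(ρ/2) > 0`.
[cite: Hales2012, Lemma 1 and proof of Theorem 2 (p. 6, "saturated spherical network")] -/
theorem exists_two_mul_h0_le_inner_of_L12 (hL12 : flyspeck_L12) {S : Set (EuclideanSpace ℝ (Fin 3))}
    (h12 : S.ncard = 12) (hn : ∀ s ∈ S, ‖s‖ = 2)
    (hp : ∀ s ∈ S, ∀ t ∈ S, s ≠ t → 2 ≤ dist s t)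
    {x : EuclideanSpace ℝ (Fin 3)} (hx : ‖x‖ = 2) :
    ∃ s ∈ S, 2 * hales_h0 ≤ ⟪x, s⟫ := by
  by_contra hcon
  push Not at hcon
  have hfin : S.Finite := Set.finite_of_ncard_ne_zero (by rw [h12]; norm_num)
  set F : Finset (EuclideanSpace ℝ (Fin 3)) := hfin.toFinset with hF
  have hFcard : F.card = 12 := by rw [hF, ← Set.ncard_eq_toFinset_card _ hfin]; exact h12
  have hmem : ∀ s, s ∈ F ↔ s ∈ S := fun s => by rw [hF, Set.Finite.mem_toFinset]
  have hFne : F.Nonempty := by rw [← Finset.card_pos, hFcard]; norm_num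
  -- the largest inner product with `x` is `< 2h₀`
  obtain ⟨s₀, hs₀, hmax⟩ := F.exists_max_image (fun s => ⟪x, s⟫) hFne
  have hm : ⟪x, s₀⟫ < 2 * hales_h0 := hcon s₀ ((hmem s₀).1 hs₀)
  -- choose the norm `ρ` of the thirteenth point
  have h2h0 : (2 : ℝ) < 2 * hales_h0 := by rw [hales_h0_eq]; norm_num
  obtain ⟨ρ, hρ1, hρ2⟩ := exists_between (max_lt h2h0 hm)
  have h2ρ : 2 < ρ := (le_max_left _ _).trans_lt hρ1
  have hmρ : ⟪x, s₀⟫ < ρ := (le_max_right _ _).trans_lt hρ1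
  set w : EuclideanSpace ℝ (Fin 3) := (ρ / 2) • x with hw
  have hw_norm : ‖w‖ = ρ := by
    rw [hw, norm_smul, Real.norm_of_nonneg (by linarith), hx]; ring
  -- `w` is at distance `> 2` from every point of `S`
  have hdist : ∀ s ∈ S, 2 < dist w s := by
    intro s hs
    have hxs : ⟪x, s⟫ < ρ := (hmax s ((hmem s).2 hs)).trans_lt hmρ
    have h1 : dist w s ^ 2 = ρ ^ 2 + 4 - ρ * ⟪x, s⟫ := by
      rw [dist_eq_norm, norm_sub_sq_real, hw_norm, hn s hs, hw, real_inner_smul_left]; ring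
    have h2 : (2 : ℝ) ^ 2 < dist w s ^ 2 := by rw [h1]; nlinarith
    exact lt_of_pow_lt_pow_left₀ 2 dist_nonneg h2
  have hwF : w ∉ F := fun h => by
    have := hdist w ((hmem w).1 h)
    rw [dist_self] at this
    linarith
  -- apply `L12` to the thirteen points
  have hsum := hL12 (insert w F) ?_ ?_
  · rw [Finset.sum_insert hwF] at hsum
    have h12' : ∑ s ∈ F, halesL (‖s‖ / 2) = 12 := by
      rw [Finset.sum_congr rfl fun s hs => by rw [hn s ((hmem s).1 hs)]]
      norm_num [halesL_one, hFcard]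
    rw [h12', hw_norm] at hsum
    have hpos : 0 < halesL (ρ / 2) := halesL_pos (by linarith)
    linarith
  · intro p hp' q hq hpq
    rcases Finset.mem_insert.1 hp' with rfl | hp'
    · rcases Finset.mem_insert.1 hq with rfl | hq
      · exact absurd rfl hpq
      · exact (hdist q ((hmem q).1 hq)).le
    · rcases Finset.mem_insert.1 hq with rfl | hq
      · rw [dist_comm]; exact (hdist p ((hmem p).1 hp')).le
      · exact hp p ((hmem p).1 hp') q ((hmem q).1 hq) hpq
  · intro p hp'
    rcases Finset.mem_insert.1 hp' with rfl | hp'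
    · rw [hw_norm]; exact ⟨h2ρ.le, hρ2.le⟩
    · rw [hn p ((hmem p).1 hp'), hales_h0_eq]; norm_num

/-- **Covering radius.** Under the same hypotheses some `s ∈ S` has
`dist x s ≤ 2√(2 − h₀)` (`= √2.96 ≈ 1.7205`; `dist² = 8 − 2⟪x, s⟫ ≤ 8 − 4h₀`).
[cite: Hales2012, Lemma 1 and proof of Theorem 2 (p. 6)] -/
theorem exists_dist_le_of_L12 (hL12 : flyspeck_L12) {S : Set (EuclideanSpace ℝ (Fin 3))}
    (h12 : S.ncard = 12) (hn : ∀ s ∈ S, ‖s‖ = 2)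
    (hp : ∀ s ∈ S, ∀ t ∈ S, s ≠ t → 2 ≤ dist s t)
    {x : EuclideanSpace ℝ (Fin 3)} (hx : ‖x‖ = 2) :
    ∃ s ∈ S, dist x s ≤ 2 * Real.sqrt (2 - hales_h0) := by
  obtain ⟨s, hs, h⟩ := exists_two_mul_h0_le_inner_of_L12 hL12 h12 hn hp hx
  refine ⟨s, hs, ?_⟩
  have h0 : (0 : ℝ) ≤ 2 - hales_h0 := by rw [hales_h0_eq]; norm_num
  have hsq : dist x s ^ 2 ≤ (2 * Real.sqrt (2 - hales_h0)) ^ 2 := by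
    rw [mul_pow, Real.sq_sqrt h0, dist_sq_eq_of_norm_eq_two hx (hn s hs)]
    linarith
  exact le_of_sq_le_sq hsq (by positivity)

/-- `2√(2 − h₀) < 2` (indeed `≈ 1.72`). [folklore] -/
theorem two_mul_sqrt_two_sub_h0_lt_two : 2 * Real.sqrt (2 - hales_h0) < 2 := by
  have h : Real.sqrt (2 - hales_h0) < 1 := by
    rw [Real.sqrt_lt' one_pos, hales_h0_eq]; norm_num
  linarith

/-- **"`V′` is a saturated spherical network on `S²(2)`"** (Hales, proof of Theorem 2): for
twelve points of `S²(2)` at pairwise distance `≥ 2` and any `x ∈ S²(2)`, some point of the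
configuration is at distance `< 2` from `x` — assuming `flyspeck_L12` (the kissing number
problem being its unweighted case). [cite: Hales2012, proof of Theorem 2 (p. 6)] -/
theorem exists_dist_lt_two_of_L12 (hL12 : flyspeck_L12) {S : Set (EuclideanSpace ℝ (Fin 3))}
    (h12 : S.ncard = 12) (hn : ∀ s ∈ S, ‖s‖ = 2)
    (hp : ∀ s ∈ S, ∀ t ∈ S, s ≠ t → 2 ≤ dist s t)
    {x : EuclideanSpace ℝ (Fin 3)} (hx : ‖x‖ = 2) :
    ∃ s ∈ S, dist x s < 2 := by
  obtain ⟨s, hs, h⟩ := exists_dist_le_of_L12 hL12 h12 hn hp hx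
  exact ⟨s, hs, h.trans_lt two_mul_sqrt_two_sub_h0_lt_two⟩

/-- **No thirteenth kissing ball** ("there is no room to add a further point on `S²(2)` that has
distance at least `2` from all points of `V′`"): the set `S ∪ {x}` is not a packing for any new
`x ∈ S²(2)`. [cite: Hales2012, proof of Theorem 2 (p. 6)] -/
theorem not_packing_thirteen_of_L12 (hL12 : flyspeck_L12) {S : Set (EuclideanSpace ℝ (Fin 3))}
    (h12 : S.ncard = 12) (hn : ∀ s ∈ S, ‖s‖ = 2)
    (hp : ∀ s ∈ S, ∀ t ∈ S, s ≠ t → 2 ≤ dist s t)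
    {x : EuclideanSpace ℝ (Fin 3)} (hx : ‖x‖ = 2) :
    ¬ ∀ s ∈ S, 2 ≤ dist x s := by
  intro h
  obtain ⟨s, hs, hlt⟩ := exists_dist_lt_two_of_L12 hL12 h12 hn hp hx
  exact absurd (h s hs) (not_le.2 hlt)

/-! ### Specialisation to Hales's class `𝒱` (`IsKissingConfig`) -/

/-- For `S ∈ 𝒱` and `x ∈ S²(2)`, some `s ∈ S` has `⟪x, s⟫ ≥ 2h₀` (angular distance
`≤ arccos 0.63`), assuming `flyspeck_L12`. [cite: Hales2012, Lemma 1 and proof of Theorem 2] -/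
theorem IsKissingConfig.exists_two_mul_h0_le_inner (hL12 : flyspeck_L12)
    {S : Set (EuclideanSpace ℝ (Fin 3))} (hS : IsKissingConfig S)
    {x : EuclideanSpace ℝ (Fin 3)} (hx : ‖x‖ = 2) : ∃ s ∈ S, 2 * hales_h0 ≤ ⟪x, s⟫ :=
  exists_two_mul_h0_le_inner_of_L12 hL12 hS.ncard_eq (fun _ hs => hS.norm_eq hs)
    (fun _ hs _ ht hst => hS.two_le_dist hs ht hst) hx

/-- For `S ∈ 𝒱` and `x ∈ S²(2)`, some `s ∈ S` has `dist x s ≤ 2√(2 − h₀) < 2`, assuming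
`flyspeck_L12`. [cite: Hales2012, proof of Theorem 2 (p. 6)] -/
theorem IsKissingConfig.exists_dist_le (hL12 : flyspeck_L12)
    {S : Set (EuclideanSpace ℝ (Fin 3))} (hS : IsKissingConfig S)
    {x : EuclideanSpace ℝ (Fin 3)} (hx : ‖x‖ = 2) :
    ∃ s ∈ S, dist x s ≤ 2 * Real.sqrt (2 - hales_h0) :=
  exists_dist_le_of_L12 hL12 hS.ncard_eq (fun _ hs => hS.norm_eq hs)
    (fun _ hs _ ht hst => hS.two_le_dist hs ht hst) hx

/-- **Every `S ∈ 𝒱` is a saturated spherical network on `S²(2)`**, assuming `flyspeck_L12`.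
[cite: Hales2012, proof of Theorem 2 (p. 6)] -/
theorem IsKissingConfig.exists_dist_lt_two (hL12 : flyspeck_L12)
    {S : Set (EuclideanSpace ℝ (Fin 3))} (hS : IsKissingConfig S)
    {x : EuclideanSpace ℝ (Fin 3)} (hx : ‖x‖ = 2) : ∃ s ∈ S, dist x s < 2 :=
  exists_dist_lt_two_of_L12 hL12 hS.ncard_eq (fun _ hs => hS.norm_eq hs)
    (fun _ hs _ ht hst => hS.two_le_dist hs ht hst) hx

end Literature.Geometry.DiscreteGeometry
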